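import Literature.Analysis.FluidPDE.CompressibleEulerImplosionFarFieldBounds
import Literature.Analysis.FluidPDE.IsentropicEulerTorusUniqueness

/-!
# The exterior solution agrees with the exact implosion on an annulus (domain of dependence)

Helper file for the support item `TypeOneIdealImplosion` (stmt-AtomisticToContinuum-15146) of the
route `ImplosionDichotomy` (`AtomisticToContinuum/HydrodynamicLimit`): the finite-speed-of-
propagation step of the transplant of the self-similar implosion to `𝕋³` (Cao-Labora–Gómez-Serrano–
Shi–Staffilani, arXiv:2310.05325, Rem. 1.5; Dafermos 2005, Thm 5.2.1; tree:
`Literature.Analysis.FluidPDE.IsentropicEuler.eqOn_cone_of_eqOn_ball`).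

In REVERSED time `s = T − t` (time to blow-up) the exact self-similar solution of the monatomic
gas generated by the Buckmaster–Cao-Labora–Gómez-Serrano profile is, off the origin, the
`T`-independent smooth field (far-field form, `Literature.Analysis.FluidPDE.CaolaboraEtAl2025.farField_form`)

  `u_R(s, x) = (r⁻¹|x|^{−r} A(s|x|^{−r})) x`,  `σ_R(s, x) = r⁻¹|x|^{1−r} B(s|x|^{−r})`,

smooth on `ℝ × (ℝ³ ∖ {0})` INCLUDING `s = 0` (the blow-up time), where it is the explicit power-law
state `((A(0)/r)|x|^{−r}x, (B(0)/r)|x|^{1−r})`. This file proves: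

* `reversedField_uσ` — `(−u_R, σ_R)` solves the `(u, σ)`-system (the time-reversed isentropic
  Euler equations are the isentropic Euler equations for `(−u, σ)`) for `s > 0`, `x ≠ 0`;
* `backward_agreement` — if `(ρ̃, ũ)` is a classical isentropic solution on `[0, T_b) × 𝕋³`,
  `T < T_b`, whose data agree with `((σ_R(0)/3)³, −u_R(0))` on the annulus `1/40 ≤ |y| ≤ 1/5`
  of the fundamental cell, and `T` is small (`T·64^r ≤ 1`, `cT < 1/32` with the explicit speed
  bound `c = r⁻¹64^{r−1}(M_A + M_B)`), then `ũ(s, proj y) = −u_R(s, y)` and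
  `ρ̃(s, proj y) = (σ_R(s, y)/3)³` for all `s ∈ [0, T)` and `1/16 ≤ |y| ≤ 1/8`: every such point
  is the tip of a backward acoustic cone of base radius `1/32` inside the annulus, on which the
  cut-off field `(−φu_R, φσ_R)` (`φ = 1` on `|x| ≥ 1/64`) is a `C¹` solution with speed `≤ c`.
-/

noncomputable section

namespace Summit.AtomisticToContinuum.HydrodynamicLimit.Theorems

open Set Filter Topology Metric
open scoped ContDiff
open Literature.MathematicalPhysics.KineticTheory
open Literature.Analysis.FunctionSpaces
open Literature.Analysis.FluidPDE (IsIsentropicEulerSolution)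
open Literature.Analysis.FluidPDE.CaolaboraEtAl2025
open Literature.Analysis.FluidPDE.IsentropicEuler

section Reversed

variable {r : ℝ} {U S A B : ℝ → ℝ}

/-- **The reversed far field solves the `(u, σ)`-system.** For the profile `(U, S)` of the vendored
fact with far-field representation `U = ζ^{1−r}A(ζ^{−r})`, `S = ζ^{1−r}B(ζ^{−r})`, the fields
`v(s, x) = −(r⁻¹|x|^{−r}A(s|x|^{−r}))x`, `w(s, x) = r⁻¹|x|^{1−r}B(s|x|^{−r})` satisfy, at every
`s > 0`, `x ≠ 0`, `∂ₛw + Dw(v) + ⅓ w div v = 0` and `∂ₛv + Dv(v) + ⅓ w∇w = 0`: on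
`{s' > 0} × {x' ≠ 0}` they are `(−u, σ)(s₀ − s', x')` for the exact self-similar solution with
blow-up time `s₀` (`farField_form`), whose `(u, σ)`-system (`uσ_system_of_ansatz`) is reversible.
[cite: CaolaboraEtAl2025, §1.3 p. 5 and Rem. 1.5 p. 7] -/
theorem reversedField_uσ (hr1 : 1 < r) (hr2 : r < 2)
    (hU : ContDiff ℝ ∞ fun y : V3 => (U ‖y‖ / ‖y‖) • y) (hS : ContDiff ℝ ∞ fun y : V3 => S ‖y‖)
    (hode : ∀ ζ : ℝ, 0 < ζ →
      (r - 1) * U ζ + (ζ + U ζ) * deriv U ζ + 1 / 3 * S ζ * deriv S ζ = 0 ∧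
      (r - 1) * S ζ + (ζ + U ζ) * deriv S ζ + 1 / 3 * S ζ * (deriv U ζ + 2 * U ζ / ζ) = 0)
    (hUrep : ∀ ζ : ℝ, 0 < ζ → U ζ = ζ ^ (1 - r) * A (ζ ^ (-r)))
    (hSrep : ∀ ζ : ℝ, 0 < ζ → S ζ = ζ ^ (1 - r) * B (ζ ^ (-r)))
    {v : ℝ → V3 → V3} {w : ℝ → V3 → ℝ} {s₀ : ℝ} (hs₀ : 0 < s₀) {x₀ : V3}
    (hv : ∀ᶠ p : ℝ × V3 in 𝓝 (s₀, x₀),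
      v p.1 p.2 = -((r⁻¹ * ‖p.2‖ ^ (-r) * A (p.1 * ‖p.2‖ ^ (-r))) • p.2))
    (hw : ∀ᶠ p : ℝ × V3 in 𝓝 (s₀, x₀), w p.1 p.2 = r⁻¹ * ‖p.2‖ ^ (1 - r) * B (p.1 * ‖p.2‖ ^ (-r)))
    (hx₀ : x₀ ≠ 0) :
    deriv (fun s => w s x₀) s₀ + fderiv ℝ (w s₀) x₀ (v s₀ x₀) +
        1 / 3 * w s₀ x₀ * ∑ i, fderiv ℝ (v s₀) x₀ (EuclideanSpace.single i 1) i = 0 ∧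
      deriv (fun s => v s x₀) s₀ + fderiv ℝ (v s₀) x₀ (v s₀ x₀) +
        (1 / 3 * w s₀ x₀) • gradient (w s₀) x₀ = 0 := by
  have hr0 : 0 < r := by linarith
  -- the exact solution with blow-up time `s₀`
  set Ub : V3 → V3 := fun y => (U ‖y‖ / ‖y‖) • y with hUb
  set Sb : V3 → ℝ := fun y => S ‖y‖ with hSb
  set uE : ℝ → V3 → V3 := fun t x => (r⁻¹ * (s₀ - t) ^ (1 / r - 1)) • Ub ((s₀ - t) ^ (-1 / r) • x)
    with huE
  set σE : ℝ → V3 → ℝ := fun t x => (r⁻¹ * (s₀ - t) ^ (1 / r - 1)) * Sb ((s₀ - t) ^ (-1 / r) • x)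
    with hσE
  have hP1 : ∀ y, (r - 1) • Ub y + fderiv ℝ Ub y (y + Ub y) + (1 / 3 * Sb y) • gradient Sb y = 0 :=
    profileEq_velocity hU hS hode
  have hP2 : ∀ y, (r - 1) * Sb y + fderiv ℝ Sb y (y + Ub y) +
      1 / 3 * Sb y * ∑ i, (fderiv ℝ Ub y (EuclideanSpace.single i 1)) i = 0 :=
    profileEq_soundSpeed hU hS hode
  -- far-field form: `uE (s₀ - s) x = (r⁻¹‖x‖^{-r} A(s‖x‖^{-r})) • x` for `s > 0`, `x ≠ 0`
  have hff : ∀ s : ℝ, 0 < s → ∀ x : V3, x ≠ 0 →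
      uE (s₀ - s) x = (r⁻¹ * ‖x‖ ^ (-r) * A (s * ‖x‖ ^ (-r))) • x ∧
        σE (s₀ - s) x = r⁻¹ * ‖x‖ ^ (1 - r) * B (s * ‖x‖ ^ (-r)) := by
    intro s hs x hx
    have h := farField_form (U := U) (S := S) (A := A) (B := B) (T := s₀) (t := s₀ - s) hr0 hUrep hSrep
      (by linarith) hx
    simp only [huE, hσE, hUb, hSb, sub_sub_cancel] at h ⊢
    exact h
  -- `v = -uE(s₀ - ·)` and `w = σE(s₀ - ·)` near `(s₀, x₀)`
  have hnbhd : ∀ᶠ p : ℝ × V3 in 𝓝 (s₀, x₀), 0 < p.1 ∧ p.2 ≠ 0 := by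
    have h1 : ∀ᶠ p : ℝ × V3 in 𝓝 (s₀, x₀), 0 < p.1 :=
      (continuous_fst.tendsto _).eventually (lt_mem_nhds hs₀)
    have h2 : ∀ᶠ p : ℝ × V3 in 𝓝 (s₀, x₀), p.2 ≠ 0 :=
      (continuous_snd.tendsto (s₀, x₀)).eventually (eventually_ne_nhds hx₀)
    exact h1.and h2
  have hvE : ∀ᶠ p : ℝ × V3 in 𝓝 (s₀, x₀), v p.1 p.2 = -uE (s₀ - p.1) p.2 := by
    filter_upwards [hv, hnbhd] with p hp hq
    rw [hp, (hff p.1 hq.1 p.2 hq.2).1]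
  have hwE : ∀ᶠ p : ℝ × V3 in 𝓝 (s₀, x₀), w p.1 p.2 = σE (s₀ - p.1) p.2 := by
    filter_upwards [hw, hnbhd] with p hp hq
    rw [hp, (hff p.1 hq.1 p.2 hq.2).2]
  -- slices of these eventual equalities
  have hvE' : ∀ᶠ s in 𝓝 s₀, ∀ᶠ x in 𝓝 x₀, v s x = -uE (s₀ - s) x := by
    have h := hvE; rw [nhds_prod_eq] at h; exact h.curry
  have hwE' : ∀ᶠ s in 𝓝 s₀, ∀ᶠ x in 𝓝 x₀, w s x = σE (s₀ - s) x := by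
    have h := hwE; rw [nhds_prod_eq] at h; exact h.curry
  have hvx : v s₀ =ᶠ[𝓝 x₀] fun x => -uE 0 x := by
    filter_upwards [hvE'.self_of_nhds] with x hx
    simpa using hx
  have hwx : w s₀ =ᶠ[𝓝 x₀] fun x => σE 0 x := by
    filter_upwards [hwE'.self_of_nhds] with x hx
    simpa using hx
  have hvs : (fun s => v s x₀) =ᶠ[𝓝 s₀] fun s => -uE (s₀ - s) x₀ :=
    hvE'.mono fun s hs => hs.self_of_nhds
  have hws : (fun s => w s x₀) =ᶠ[𝓝 s₀] fun s => σE (s₀ - s) x₀ :=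
    hwE'.mono fun s hs => hs.self_of_nhds
  -- the `(u, σ)`-system of the exact solution at `(t, x) = (0, x₀)`
  obtain ⟨hut, hux, hσt, hσx, hM, hZ⟩ := uσ_system_of_ansatz (T := s₀) (u := uE) (σ := σE)
    hr0.ne' (hU.of_le (by norm_cast)) (hS.of_le (by norm_cast)) hP1 hP2
    (fun _ _ => rfl) (fun _ _ => rfl) hs₀ x₀
  -- values at the point
  have hv0 : v s₀ x₀ = -uE 0 x₀ := hvx.self_of_nhds
  have hw0 : w s₀ x₀ = σE 0 x₀ := hwx.self_of_nhds
  -- derivatives of `v`, `w` at `(s₀, x₀)`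
  have hdv : deriv (fun s => v s x₀) s₀ = deriv (fun τ => uE τ x₀) 0 := by
    rw [hvs.deriv_eq]
    have h1 := deriv_comp_const_sub (f := fun τ => uE τ x₀) (a := s₀) (x := s₀)
    simp only [sub_self] at h1
    rw [deriv.fun_neg, h1, neg_neg]
  have hdw : deriv (fun s => w s x₀) s₀ = -deriv (fun τ => σE τ x₀) 0 := by
    rw [hws.deriv_eq]
    have h1 := deriv_comp_const_sub (f := fun τ => σE τ x₀) (a := s₀) (x := s₀)
    simp only [sub_self] at h1
    exact h1
  have hfv : fderiv ℝ (v s₀) x₀ = -fderiv ℝ (uE 0) x₀ := by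
    rw [hvx.fderiv_eq]; exact fderiv_neg
  have hfw : fderiv ℝ (w s₀) x₀ = fderiv ℝ (σE 0) x₀ := by
    rw [hwx.fderiv_eq]
  have hgw : gradient (w s₀) x₀ = gradient (σE 0) x₀ := by
    rw [hwx.gradient_eq]
  rw [hdv, hdw, hfv, hfw, hgw, hv0, hw0]
  rw [hux.fderiv] at hM hZ ⊢
  rw [hσx.fderiv] at hZ ⊢
  constructor
  · simp only [map_neg, neg_apply, PiLp.neg_apply, Finset.sum_neg_distrib]
    linear_combination (-1 : ℝ) * hZ
  · simp only [map_neg, neg_apply, neg_neg]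
    exact hM

/-- `|x|^{-r} ≤ 64^r` and `|x|^{1-r} ≤ 64^{r-1}` for `|x| ≥ 1/64`, `r ≥ 1`. [folklore] -/
theorem rpow_bounds_of_norm_ge {x : V3} (hx : 1 / 64 ≤ ‖x‖) (hr : 1 ≤ r) :
    ‖x‖ ^ (-r) ≤ 64 ^ r ∧ ‖x‖ ^ (1 - r) ≤ 64 ^ (r - 1) := by
  have hx0 : 0 < ‖x‖ := lt_of_lt_of_le (by norm_num) hx
  constructor
  · calc ‖x‖ ^ (-r) ≤ (1 / 64 : ℝ) ^ (-r) :=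
          Real.rpow_le_rpow_of_nonpos (by norm_num) hx (by linarith)
      _ = 64 ^ r := by
          rw [one_div, Real.rpow_neg (by norm_num), Real.inv_rpow (by norm_num), inv_inv]
  · calc ‖x‖ ^ (1 - r) ≤ (1 / 64 : ℝ) ^ (1 - r) :=
          Real.rpow_le_rpow_of_nonpos (by norm_num) hx (by linarith)
      _ = 64 ^ (r - 1) := by
          rw [one_div, Real.inv_rpow (by norm_num), ← Real.rpow_neg (by norm_num), neg_sub]

/-- **Speed bound for the reversed far field** on `{|x| ≥ 1/64}`, `0 ≤ s ≤ T`, `T·64^r ≤ 1`: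
`‖v‖ + |w/3| ≤ r⁻¹64^{r−1}(M_A + M_B)` where `M_A, M_B` bound `|A|, |B|` on `[0, 1]`. [folklore] -/
theorem reversedField_speed_le (hr1 : 1 < r) {MA MB T s : ℝ} {x : V3}
    (hMA : ∀ τ ∈ Icc (0 : ℝ) 1, |A τ| ≤ MA) (hMB : ∀ τ ∈ Icc (0 : ℝ) 1, |B τ| ≤ MB)
    (hT : T * 64 ^ r ≤ 1) (hs0 : 0 ≤ s) (hsT : s ≤ T) (hx : 1 / 64 ≤ ‖x‖) :
    ‖-((r⁻¹ * ‖x‖ ^ (-r) * A (s * ‖x‖ ^ (-r))) • x)‖ +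
        |1 / 3 * (r⁻¹ * ‖x‖ ^ (1 - r) * B (s * ‖x‖ ^ (-r)))| ≤
      r⁻¹ * 64 ^ (r - 1) * (MA + MB) := by
  have hr0 : 0 < r := by linarith
  have hx0 : 0 < ‖x‖ := lt_of_lt_of_le (by norm_num) hx
  obtain ⟨hxr, hx1r⟩ := rpow_bounds_of_norm_ge hx hr1.le
  -- the argument `s‖x‖^{-r}` lies in `[0, 1]`
  have harg : s * ‖x‖ ^ (-r) ∈ Icc (0 : ℝ) 1 := by
    refine ⟨mul_nonneg hs0 (Real.rpow_nonneg hx0.le _), ?_⟩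
    calc s * ‖x‖ ^ (-r) ≤ T * 64 ^ r :=
          mul_le_mul hsT hxr (Real.rpow_nonneg hx0.le _) (hs0.trans hsT)
      _ ≤ 1 := hT
  have hA := hMA _ harg
  have hB := hMB _ harg
  have hMA0 : 0 ≤ MA := (abs_nonneg _).trans hA
  have hMB0 : 0 ≤ MB := (abs_nonneg _).trans hB
  have h1 : ‖-((r⁻¹ * ‖x‖ ^ (-r) * A (s * ‖x‖ ^ (-r))) • x)‖ =
      r⁻¹ * ‖x‖ ^ (1 - r) * |A (s * ‖x‖ ^ (-r))| := by
    rw [norm_neg, norm_smul, Real.norm_eq_abs, abs_mul, abs_mul, abs_of_pos (inv_pos.2 hr0),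
      abs_of_pos (Real.rpow_pos_of_pos hx0 _), sub_eq_add_neg, Real.rpow_add hx0, Real.rpow_one]
    ring
  have h2 : |1 / 3 * (r⁻¹ * ‖x‖ ^ (1 - r) * B (s * ‖x‖ ^ (-r)))| =
      1 / 3 * (r⁻¹ * ‖x‖ ^ (1 - r) * |B (s * ‖x‖ ^ (-r))|) := by
    rw [abs_mul, abs_mul, abs_mul, abs_of_pos (by norm_num : (0:ℝ) < 1 / 3), abs_of_pos (inv_pos.2 hr0),
      abs_of_pos (Real.rpow_pos_of_pos hx0 _)]
  rw [h1, h2]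
  have hc : 0 ≤ r⁻¹ * ‖x‖ ^ (1 - r) := by positivity
  have hc' : r⁻¹ * ‖x‖ ^ (1 - r) ≤ r⁻¹ * 64 ^ (r - 1) := mul_le_mul_of_nonneg_left hx1r (inv_pos.2 hr0).le
  calc r⁻¹ * ‖x‖ ^ (1 - r) * |A (s * ‖x‖ ^ (-r))| + 1 / 3 * (r⁻¹ * ‖x‖ ^ (1 - r) * |B (s * ‖x‖ ^ (-r))|)
      ≤ r⁻¹ * ‖x‖ ^ (1 - r) * MA + r⁻¹ * ‖x‖ ^ (1 - r) * MB := by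
        nlinarith [mul_le_mul_of_nonneg_left hA hc, mul_le_mul_of_nonneg_left hB hc]
    _ = r⁻¹ * ‖x‖ ^ (1 - r) * (MA + MB) := by ring
    _ ≤ r⁻¹ * 64 ^ (r - 1) * (MA + MB) := mul_le_mul_of_nonneg_right hc' (by positivity)

end Reversed

/-! ## The exterior solution agrees with the exact implosion near the glueing annulus -/

section Agreement

variable {r : ℝ} {U S A B : ℝ → ℝ}

/-- **Backward domain of dependence for the transplanted implosion.** Let `(U, S)` be the profile
of the vendored fact with its far-field representation (`A, B` smooth, `B(0) > 0`), and let
`v(s,x) = −(r⁻¹|x|^{−r}A(s|x|^{−r}))x`, `w(s,x) = r⁻¹|x|^{1−r}B(s|x|^{−r})` be the reversed exact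
solution off the origin. Let `(ρ̃, ũ)` be a classical isentropic solution (`γ = 5/3`) on
`[0, T_b) × 𝕋³`, `T < T_b`, with `ũ(0, proj y) = v(0, y)`, `ρ̃(0, proj y) = (w(0, y)/3)³` for
`1/40 ≤ |y| ≤ 1/5`. If `T·64^r ≤ 1` and `cT < 1/32`, `c = r⁻¹64^{r−1}(M_A + M_B)` (`M_A, M_B`
bounds for `|A|, |B|` on `[0,1]`), then `ũ(s, proj y) = v(s, y)` and
`ρ̃(s, proj y) = (w(s, y)/3)³` for all `s ∈ [0, T)`, `1/16 ≤ |y| ≤ 1/8`. Proof: Dafermos's local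
uniqueness in the backward acoustic cone `{|x − y| + cs < 1/32}` (tree:
`IsentropicEuler.eqOn_cone_of_eqOn_ball`) applied to the periodic lift of `(ũ, 3ρ̃^{1/3})`
(`IsentropicEuler.uσ_equations`) and to the cut-off field `(φv, φw)`, `φ = 1` on `|x| ≥ 1/64`,
which is `C¹` on the closed slab (it is smooth across the blow-up time `s = 0`), solves the
`(u, σ)`-system in the cone (`reversedField_uσ`) and has speed `≤ c` there
(`reversedField_speed_le`). [cite: Dafermos2005, §5.2 Thm 5.2.1] [cite: CaolaboraEtAl2025, Rem. 1.5 p. 7] -/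
theorem backward_agreement (hr1 : 1 < r) (hr2 : r < 2)
    (hU : ContDiff ℝ ∞ fun y : V3 => (U ‖y‖ / ‖y‖) • y) (hS : ContDiff ℝ ∞ fun y : V3 => S ‖y‖)
    (hode : ∀ ζ : ℝ, 0 < ζ →
      (r - 1) * U ζ + (ζ + U ζ) * deriv U ζ + 1 / 3 * S ζ * deriv S ζ = 0 ∧
      (r - 1) * S ζ + (ζ + U ζ) * deriv S ζ + 1 / 3 * S ζ * (deriv U ζ + 2 * U ζ / ζ) = 0)
    (hA : ContDiff ℝ ∞ A) (hB : ContDiff ℝ ∞ B) (hB0 : ∀ τ, 0 ≤ τ → 0 < B τ)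
    (hUrep : ∀ ζ : ℝ, 0 < ζ → U ζ = ζ ^ (1 - r) * A (ζ ^ (-r)))
    (hSrep : ∀ ζ : ℝ, 0 < ζ → S ζ = ζ ^ (1 - r) * B (ζ ^ (-r)))
    {MA MB : ℝ} (hMA : ∀ τ ∈ Icc (0 : ℝ) 1, |A τ| ≤ MA) (hMB : ∀ τ ∈ Icc (0 : ℝ) 1, |B τ| ≤ MB)
    {T Tb : ℝ} (hT : 0 < T) (hTb : T < Tb) (hT64 : T * 64 ^ r ≤ 1)
    (hcT : r⁻¹ * 64 ^ (r - 1) * (MA + MB) * T < 1 / 32)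
    {ρ : ℝ → T3 → ℝ} {u : ℝ → T3 → V3} (hsol : IsIsentropicEulerSolution (5 / 3) Tb ρ u)
    (hdata : ∀ y : V3, 1 / 40 ≤ ‖y‖ → ‖y‖ ≤ 1 / 5 →
      u 0 (Torus.proj y) = -((r⁻¹ * ‖y‖ ^ (-r) * A 0) • y) ∧
        ρ 0 (Torus.proj y) = (r⁻¹ * ‖y‖ ^ (1 - r) * B 0 / 3) ^ 3)
    {s : ℝ} (hs : s ∈ Ico 0 T) {y : V3} (hy1 : 1 / 16 ≤ ‖y‖) (hy2 : ‖y‖ ≤ 1 / 8) :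
    u s (Torus.proj y) = -((r⁻¹ * ‖y‖ ^ (-r) * A (s * ‖y‖ ^ (-r))) • y) ∧
      ρ s (Torus.proj y) = (r⁻¹ * ‖y‖ ^ (1 - r) * B (s * ‖y‖ ^ (-r)) / 3) ^ 3 := by
  have hr0 : 0 < r := by linarith
  classical
  -- the cut-off and the comparison field
  obtain ⟨φ, hφ, hφ0, hφ1, -⟩ := exists_radial_cutoff (a := 1 / 128) (b := 1 / 64) (by norm_num) (by norm_num)
  set v : ℝ → V3 → V3 := fun s x => -(φ x • ((r⁻¹ * ‖x‖ ^ (-r) * A (s * ‖x‖ ^ (-r))) • x)) with hv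
  set w : ℝ → V3 → ℝ := fun s x => φ x * (r⁻¹ * ‖x‖ ^ (1 - r) * B (s * ‖x‖ ^ (-r))) with hw
  -- smoothness of the comparison field on all of `ℝ × ℝ³`
  have hvs : ContDiff ℝ ∞ fun p : ℝ × V3 => v p.1 p.2 := by
    have h := contDiff_cutoff_mul (G := V3) hφ (by norm_num : (0:ℝ) < 1 / 128) hφ0
      (g := fun q : ℝ × V3 => (r⁻¹ * ‖q.2‖ ^ (-r) * A (q.1 * ‖q.2‖ ^ (-r))) • q.2)
      (fun q hq => ((contDiffAt_const.mul (contDiffAt_norm_rpow hq)).mul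
        (hA.contDiffAt.comp q (contDiffAt_fst.mul (contDiffAt_norm_rpow hq)))).smul contDiffAt_snd)
    exact h.neg
  have hws : ContDiff ℝ ∞ fun p : ℝ × V3 => w p.1 p.2 := by
    have h := contDiff_cutoff_mul (G := ℝ) hφ (by norm_num : (0:ℝ) < 1 / 128) hφ0
      (g := fun q : ℝ × V3 => r⁻¹ * ‖q.2‖ ^ (1 - r) * B (q.1 * ‖q.2‖ ^ (-r)))
      (fun q hq => (contDiffAt_const.mul (contDiffAt_norm_rpow hq)).mul
        (hB.contDiffAt.comp q (contDiffAt_fst.mul (contDiffAt_norm_rpow hq))))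
    simpa only [smul_eq_mul] using h
  -- the speed bound constant
  set c : ℝ := r⁻¹ * 64 ^ (r - 1) * (MA + MB) with hc
  have hMA0 : 0 ≤ MA := (abs_nonneg _).trans (hMA 0 ⟨le_rfl, zero_le_one⟩)
  have hMB0 : 0 ≤ MB := (abs_nonneg _).trans (hMB 0 ⟨le_rfl, zero_le_one⟩)
  have hc0 : 0 ≤ c := by positivity
  -- the `(u, σ)` variables of the torus solution
  set α : ℝ := (5 / 3 - 1) / 2 with hα
  have hα3 : α = 1 / 3 := by norm_num [hα]
  have key := eqOn_cone_of_eqOn_ball (ι := Fin 3) (α := α) (c := c) (R := 1 / 32) (x₀ := y)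
    (t₁ := T) (u₁ := v) (u₂ := fun s z => u s (Torus.proj z)) (σ₁ := w)
    (σ₂ := fun s z => α⁻¹ * ρ s (Torus.proj z) ^ α)
    (hvs.of_le (by norm_cast)).contDiffOn (contDiffOn_lift_velocity hsol hTb.le)
    (hws.of_le (by norm_cast)).contDiffOn (contDiffOn_lift_soundSpeed hsol α hTb.le)
    ?_ ?_ ?_ hc0 ?_ hs (x := y) (by rw [sub_self, norm_zero, zero_add]; nlinarith [hs.2, hs.1])
  · -- read off the conclusion
    obtain ⟨h1, h2⟩ := key
    have hy64 : 1 / 64 ≤ ‖y‖ := by linarith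
    have hφy : φ y = 1 := hφ1 y hy64
    have hy0 : 0 < ‖y‖ := by linarith
    refine ⟨?_, ?_⟩
    · rw [← h1]; simp only [hv, hφy, one_smul]
    · -- `3 ρ^{1/3} = w`, so `ρ = (w/3)³`
      have hρpos : 0 < ρ s (Torus.proj y) := hsol.density_pos s ⟨hs.1, hs.2.trans hTb⟩ _
      have h3 : α⁻¹ * ρ s (Torus.proj y) ^ α = r⁻¹ * ‖y‖ ^ (1 - r) * B (s * ‖y‖ ^ (-r)) := by
        rw [← h2]; simp only [hw, hφy, one_mul]
      rw [hα3] at h3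
      have h4 : ρ s (Torus.proj y) ^ (1 / 3 : ℝ) = r⁻¹ * ‖y‖ ^ (1 - r) * B (s * ‖y‖ ^ (-r)) / 3 := by
        rw [← h3]; ring
      calc ρ s (Torus.proj y) = (ρ s (Torus.proj y) ^ (1 / 3 : ℝ)) ^ 3 := by
            rw [← Real.rpow_natCast _ 3, ← Real.rpow_mul hρpos.le]; norm_num
        _ = _ := by rw [h4]
  · -- the comparison field solves the `(u, σ)`-system in the cone
    intro s' hs' x hx
    have hx64 : 1 / 64 < ‖x‖ := by
      have h1 : ‖x - y‖ < 1 / 32 := by nlinarith [mul_nonneg hc0 hs'.1.le]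
      have := norm_sub_norm_le y x
      rw [norm_sub_rev] at this
      linarith
    have hx0 : x ≠ 0 := by
      intro h; rw [h, norm_zero] at hx64; linarith
    -- `φ = 1` near `x`, so `v`, `w` are the reversed far field near `(s', x)`
    have hnb : ∀ᶠ p : ℝ × V3 in 𝓝 (s', x), 1 / 64 < ‖p.2‖ :=
      (continuous_snd.norm.tendsto _).eventually (lt_mem_nhds hx64)
    have hvE : ∀ᶠ p : ℝ × V3 in 𝓝 (s', x),
        v p.1 p.2 = -((r⁻¹ * ‖p.2‖ ^ (-r) * A (p.1 * ‖p.2‖ ^ (-r))) • p.2) := by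
      filter_upwards [hnb] with p hp
      simp only [hv, hφ1 p.2 hp.le, one_smul]
    have hwE : ∀ᶠ p : ℝ × V3 in 𝓝 (s', x),
        w p.1 p.2 = r⁻¹ * ‖p.2‖ ^ (1 - r) * B (p.1 * ‖p.2‖ ^ (-r)) := by
      filter_upwards [hnb] with p hp
      simp only [hw, hφ1 p.2 hp.le, one_mul]
    have h := reversedField_uσ hr1 hr2 hU hS hode hUrep hSrep hs'.1 hvE hwE hx0
    rw [hα3]
    exact h
  · -- the torus solution solves it everywhere
    intro s' hs' x _
    exact uσ_equations hsol (by norm_num) ⟨hs'.1, hs'.2.trans hTb⟩ x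
  · -- speed bound in the cone
    intro s' hs' x hx
    have hx64 : 1 / 64 ≤ ‖x‖ := by
      have h1 : ‖x - y‖ < 1 / 32 := by nlinarith [mul_nonneg hc0 hs'.1.le]
      have := norm_sub_norm_le y x
      rw [norm_sub_rev] at this
      linarith
    have hφx : φ x = 1 := hφ1 x hx64
    have h := reversedField_speed_le (A := A) (B := B) hr1 hMA hMB hT64 hs'.1.le hs'.2.le hx64
    simp only [hv, hw, hφx, one_smul, one_mul, hα3]
    exact h
  · -- the data agree on the base ball
    intro x hx
    have hxy : ‖x - y‖ < 1 / 32 := hx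
    have hx1 : 1 / 40 ≤ ‖x‖ := by
      have := norm_sub_norm_le y x; rw [norm_sub_rev] at this; linarith
    have hx2 : ‖x‖ ≤ 1 / 5 := by
      have := norm_sub_norm_le x y; linarith
    have hφx : φ x = 1 := hφ1 x (by linarith)
    have hx0 : 0 < ‖x‖ := by linarith
    obtain ⟨hu0, hρ0⟩ := hdata x hx1 hx2
    refine ⟨?_, ?_⟩
    · simp only [hv, hφx, one_smul, zero_mul, hu0]
    · simp only [hw, hφx, one_mul, zero_mul, hρ0]
      have hpos : 0 < r⁻¹ * ‖x‖ ^ (1 - r) * B 0 / 3 :=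
        div_pos (mul_pos (mul_pos (inv_pos.2 hr0) (Real.rpow_pos_of_pos hx0 _)) (hB0 0 le_rfl)) three_pos
      rw [hα3, ← Real.rpow_natCast _ 3, ← Real.rpow_mul hpos.le]
      norm_num
      ring

end Agreement

end Summit.AtomisticToContinuum.HydrodynamicLimit.Theorems

end
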